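import Summits.ResolutionOfSingularities.ResolutionOfSingularities.Theorems.WeightedInvariantPointDrop
import Summits.ResolutionOfSingularities.ResolutionOfSingularities.Theorems.WeightedInvariantIota3Tau
import Summits.ResolutionOfSingularities.ResolutionOfSingularities.Theorems.WeightedInvariantP3bDrop
import Summits.ResolutionOfSingularities.ResolutionOfSingularities.Theorems.WeightedInvariantIota3SigmaAscent
import HarnessLib

/-!
# Sketch-R7 (res-L1-w43-idea-2, ROUND 7, technique B «data-driven datum axioms from the atlas») — TYPED FIRST STEPS, def-free over
the tree vocabulary (`PointDropOf`, `WeightTame`, `iotaFlatT`, `iotaSigma`, `IsIsolatedPosition`, `cobordantAlgebra'`).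

[OURS · L1 W4.3 · candidates · conjecture-grade statements of OUR key's P3 rung (door `HypersurfaceCentreConstruction`, stmt-19897;
legacy crux `WeightedConstruction`, stmt-0571); NOT statements of the manuscript under review (Hironaka 2017, [claim: Hironaka2017,
status: under-review]); AI typing, weaker than expert review.]

Contents (all `def … : Prop`, no `sorry`, plus three tiny proved seams):
* §1 `KWildIsolatedDrop p` / `KTameIsolatedDrop p` / `KIsolatedDrop p` — the kernel claim (K) of IOTA3-DESIGN v1.3.3 §9.4 for the letter of
  record `ι₃ᵗ = iotaFlatT`, split by the weight-tameness cut (t2) = `WeightTame` (res-type-073); `PointDropOf.union_tame` +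
  `kIsolatedDrop_iff` PROVE «(K) = (K-tame) ∧ (K-wild)» (the OPEN box (K-wild) of RULING gen 11 #6, typed on its own for the first time).
* §2 the SLICE DICTIONARY behind the σ-orbit census (job-r7): `IsFormallyBijective φ`, `SigmaFormallyInvariant` (σ and ν are invariant
  along local maps inducing `S/𝔪ⁿ ≃ S′/𝔪′ⁿ` for all `n` — the DESCENT half missing from res-type-057's ascent file, for this subclass),
  `FormallyBijectiveOfFlatUnramified` (057's ascent class + residue-field surjectivity ⇒ formally bijective).  Reading: the census computes
  `σ` at the orbit-generic successor prime `𝔮_C` through the transversal slice `O_{Z,P}` over `k(C) = K(μ)`; these two statements are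
  what makes that reading equal to `iotaSigma (B_{𝔮_C}) g`.
* §3 `QuasiHomogeneousNoTie p` — the datum axiom the census suggests first: at an ISOLATED position whose equation is weighted-homogeneous
  of degree `r₁ν` in the centre's parameters, NO successor prime off the vertex is a `ν`-tie (order drops everywhere) — (K), tame or wild,
  holds there for every `ν`-first letter.
-/

noncomputable section

open IsLocalRing Literature.AlgebraicGeometry.Resolution
open Summit.ResolutionOfSingularities.ResolutionOfSingularities.Theorems

set_option linter.dupNamespace false

namespace Summit.ResolutionOfSingularities.ResolutionOfSingularities.Cruxes.HypersurfaceCentreConstruction.LocalEngine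

namespace Iota3

namespace R7

/-! ## §1 (K) split by weight-tameness -/

/-- [OURS · R7 · (K-wild) typed] the point-centre drop for `ι₃ᵗ` at ISOLATED positions that are NOT weight-tame
(some σ-attaining primitive triple has a weight divisible by `p`): the OPEN box of RULING gen 11 #6. -/
def KWildIsolatedDrop (p : ℕ) : Prop :=
  PointDropOf IsIsolatedPosition (fun R _ f => ¬ WeightTame p R f) iotaFlatT p

/-- [OURS · R7 · (K-tame) typed] the same drop under the cut (t2) (res-type-073's (K1)/(K2) territory). -/
def KTameIsolatedDrop (p : ℕ) : Prop :=
  PointDropOf IsIsolatedPosition (WeightTame p) iotaFlatT p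

/-- [OURS · R7 · (K) typed] the drop at every isolated position, no cut. -/
def KIsolatedDrop (p : ℕ) : Prop :=
  PointDropOf IsIsolatedPosition (fun _ _ _ => True) iotaFlatT p

/-- A drop under a cut `Tame` and a drop under its negation give the drop with no cut. [folklore] -/
theorem _root_.Summit.ResolutionOfSingularities.ResolutionOfSingularities.Cruxes.HypersurfaceCentreConstruction.LocalEngine.Iota3.PointDropOf.union_tame
    {Pos : (R : Type) → [CommRing R] → [IsLocalRing R] → R → Prop} {Tame : (R : Type) → [CommRing R] → R → Prop}
    {ι : (R : Type) → [CommRing R] → R → Ordinal.{0}} {p : ℕ}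
    (h : PointDropOf Pos Tame ι p) (h' : PointDropOf Pos (fun R _ f => ¬ Tame R f) ι p) :
    PointDropOf Pos (fun _ _ _ => True) ι p :=
  fun k₀ _ _ _ S _ _ _ _ f hdim hf0 hf2 hpos _ ν hν x g₁ g₂ q r₁ r₂ hspan hrk hmax hprim =>
    (Classical.em (Tame S f)).elim
      (fun ht => h k₀ S f hdim hf0 hf2 hpos ht ν hν x g₁ g₂ q r₁ r₂ hspan hrk hmax hprim)
      (fun ht => h' k₀ S f hdim hf0 hf2 hpos ht ν hν x g₁ g₂ q r₁ r₂ hspan hrk hmax hprim)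

/-- **(K) = (K-tame) ∧ (K-wild)**. [folklore] -/
theorem kIsolatedDrop_iff (p : ℕ) : KIsolatedDrop p ↔ KTameIsolatedDrop p ∧ KWildIsolatedDrop p :=
  ⟨fun h => ⟨PointDropOf.mono_tame (fun _ _ _ _ => trivial) h, PointDropOf.mono_tame (fun _ _ _ _ => trivial) h⟩,
    fun h => PointDropOf.union_tame h.1 h.2⟩

/-! ## §2 The slice dictionary (letter side): formal bijectivity and σ -/

section Dictionary

variable {S S' : Type} [CommRing S] [CommRing S'] [IsLocalRing S] [IsLocalRing S']

/-- [OURS · R7] A ring homomorphism of local rings is **formally bijective**: it induces bijections `S/𝔪ⁿ → S′/𝔪′ⁿ` for every `n`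
(elementary form: `φ⁻¹(𝔪′ⁿ) = 𝔪ⁿ` and every class mod `𝔪′ⁿ` is hit).  Example of record (job-r7): `B_{𝔮_C} → O_{Z,P}` for a
`𝔾_m`-orbit curve `C` of the exceptional divisor and a coordinate slice `Z` transversal to `C` at its tautological `k(C)`-point `P`. -/
def IsFormallyBijective (φ : S →+* S') : Prop :=
  (∀ n : ℕ, (maximalIdeal S' ^ n).comap φ = maximalIdeal S ^ n) ∧
    ∀ (n : ℕ) (s' : S'), ∃ s : S, φ s - s' ∈ maximalIdeal S' ^ n

end Dictionary

/-- [OURS · R7 · (c11σ-formal) · candidate, expected PROVABLE NOW] **σ and ν are formal invariants**: along a formally bijective map of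
Noetherian local rings, `iotaSigma` and `iotaOrd` of `f` and of `φ f` agree.  (Reason: `ν` by `φ⁻¹(𝔪′ⁿ) = 𝔪ⁿ`; a reach condition
`f ∈ F_{g₁,g₂}^{(q;r₁,r₂)}(r₁ν)` only sees `S/𝔪^N` for `N = ⌈r₁ν/q⌉` since the filtration contains `𝔪^N`, and flags upstairs are
approximated mod `𝔪′^N` by images of flags downstairs — the DESCENT half that res-type-057's ascent file leaves open, for this subclass.) -/
def SigmaFormallyInvariant : Prop :=
  ∀ (S S' : Type) [CommRing S] [CommRing S'] [IsLocalRing S] [IsLocalRing S'] [IsNoetherianRing S] [IsNoetherianRing S']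
    (φ : S →+* S'), IsFormallyBijective φ →
    ∀ f : S, iotaOrd S' (φ f) = iotaOrd S f ∧ iotaSigma S' (φ f) = iotaSigma S f

/-- [OURS · R7 · candidate, expected PROVABLE NOW] **057's ascent class + residue surjectivity ⇒ formally bijective**: a FLAT algebra of
local rings with `𝔪S′ = 𝔪′` whose residue-field map is onto is formally bijective (faithful flatness gives `φ⁻¹(𝔪ⁿS′) = 𝔪ⁿ`;
`S′ = φ(S) + 𝔪′` and `𝔪′ᵏ = φ(𝔪ᵏ)S′` give surjectivity mod `𝔪′ⁿ`).  The slice map `B_{𝔮_C} → O_{Z,P}` is in this class (local map of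
regular local rings of the same dimension with `𝔪 ↦ 𝔪′`: flat by miracle flatness; residue fields `k(C) = K(μ)` on both sides). -/
def FormallyBijectiveOfFlatUnramified : Prop :=
  ∀ (S S' : Type) [CommRing S] [CommRing S'] [IsLocalRing S] [IsLocalRing S'] [IsNoetherianRing S'] [Algebra S S']
    [Module.Flat S S'],
    (maximalIdeal S).map (algebraMap S S') = maximalIdeal S' →
    (∀ s' : S', ∃ s : S, algebraMap S S' s - s' ∈ maximalIdeal S') →
    IsFormallyBijective (algebraMap S S')

/-! ## §3 The first datum axiom from the census: quasi-homogeneous isolated positions are tie-free -/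

/-- [OURS · R7 · (QH-NoTie) · candidate datum axiom, expected PROVABLE NOW (L-sized)] At an ISOLATED position `(S, f)` (regular local,
essentially of finite type over a perfect field `k₀` of characteristic `p`, Krull dimension `≤ 3`, `iotaOrd S f = ν`) whose equation is
**weighted-homogeneous of degree `r₁ν`** in a regular system of parameters `(x, g₂, g₁)` with positive weights `(q, r₂, r₁)` and
coefficients in `k₀` — `f = φ(x, g₂, g₁)`, `φ ∈ k₀[X₀,X₁,X₂]` `(q,r₂,r₁)`-homogeneous of degree `r₁ν` — the weighted blow-up of `𝔪` with
these weights has **no `ν`-tie successor**: at every prime `𝔫 ∋ T′` of the cobordant algebra not containing the vertex ideal, the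
`T′`-saturated transform `g` has `iotaOrd (B_𝔫) g < iotaOrd S f`.  (Reason: `f·t^{r₁ν} = φ(U)` so `g = φ(U)` is `T′`-free; modulo `T′`,
`B/T′ ≅ k[Ū]` weighted-graded and `Σ_ν(φ̄)` is a `𝔾_m`-stable cone, which isolatedness of `f` (read in `Ŝ = k⟦X⟧`, coefficient field
`⊇ k₀`) forces to be the vertex alone.)  Census j280511/j280548: every Brieskorn–Pham / hidden-quasi-homogeneous isolated start
(E₈, E₆, D₄, `x²+y³+z⁷+yz⁴ = (x+z³+yz)²+(y+z²)³+z⁷` over 𝔽₂, …) has ZERO tie orbits under the exact σ-weights, tame or wild. -/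
def QuasiHomogeneousNoTie (p : ℕ) : Prop :=
  ∀ (k₀ : Type) [Field k₀] [CharP k₀ p] [PerfectField k₀]
    (S : Type) [CommRing S] [Algebra k₀ S] [Algebra.EssFiniteType k₀ S] [IsRegularLocalRing S] (f : S),
    ringKrullDim S ≤ 3 → f ≠ 0 → f ∈ (maximalIdeal S) ^ 2 → IsIsolatedPosition S f →
    ∀ (ν : ℕ), iotaOrd S f = ν →
    ∀ (x g₁ g₂ : S) (q r₁ r₂ : ℕ),
      Ideal.span {x, g₂, g₁} = maximalIdeal S → (maximalIdeal S).spanFinrank = 3 → 0 < q → 0 < r₂ → 0 < r₁ →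
      (∃ φ : MvPolynomial (Fin 3) k₀,
          MvPolynomial.IsWeightedHomogeneous (![q, r₂, r₁] : Fin 3 → ℕ) φ (r₁ * ν) ∧ MvPolynomial.aeval ![x, g₂, g₁] φ = f) →
      ∀ (𝔫 : Ideal (cobordantAlgebra' ![x, g₂, g₁] ![q, r₂, r₁])) [𝔫.IsPrime],
        cobordantT' ![x, g₂, g₁] ![q, r₂, r₁] ∈ 𝔫 →
        ¬ (extReesAlgebra.vertexIdeal (weightedMonomialIdeal ![x, g₂, g₁] ![q, r₂, r₁]) ≤ 𝔫) →
        ∀ (a : ℕ) (g : cobordantAlgebra' ![x, g₂, g₁] ![q, r₂, r₁]),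
          algebraMap S (cobordantAlgebra' ![x, g₂, g₁] ![q, r₂, r₁]) f = cobordantT' ![x, g₂, g₁] ![q, r₂, r₁] ^ a * g →
          ¬ (cobordantT' ![x, g₂, g₁] ![q, r₂, r₁] ∣ g) →
          iotaOrd (Localization.AtPrime 𝔫) (algebraMap (cobordantAlgebra' ![x, g₂, g₁] ![q, r₂, r₁]) (Localization.AtPrime 𝔫) g)
            < iotaOrd S f

/-- (QH-NoTie) gives the (drop) conjunct at such positions for EVERY invariant `ι` that is `ν`-first, i.e. `ι R g < ι S f` whenever
`iotaOrd R g < iotaOrd S f` — stated as the implication to `WeightedDrop ι` under that monotonicity hypothesis. [folklore] -/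
theorem weightedDrop_of_quasiHomogeneousNoTie {p : ℕ} (h : QuasiHomogeneousNoTie p)
    (ι : (R : Type) → [CommRing R] → R → Ordinal.{0})
    (k₀ : Type) [Field k₀] [CharP k₀ p] [PerfectField k₀]
    (S : Type) [CommRing S] [Algebra k₀ S] [Algebra.EssFiniteType k₀ S] [IsRegularLocalRing S] (f : S)
    (hν1 : ∀ (R : Type) [CommRing R] (g : R), iotaOrd R g < iotaOrd S f → ι R g < ι S f)
    (hdim : ringKrullDim S ≤ 3) (hf0 : f ≠ 0) (hf2 : f ∈ (maximalIdeal S) ^ 2) (hiso : IsIsolatedPosition S f)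
    {ν : ℕ} (hν : iotaOrd S f = ν) {x g₁ g₂ : S} {q r₁ r₂ : ℕ}
    (hspan : Ideal.span {x, g₂, g₁} = maximalIdeal S) (hrk : (maximalIdeal S).spanFinrank = 3) (hq : 0 < q) (hr₂ : 0 < r₂) (hr₁ : 0 < r₁)
    (hqh : ∃ φ : MvPolynomial (Fin 3) k₀,
      MvPolynomial.IsWeightedHomogeneous (![q, r₂, r₁] : Fin 3 → ℕ) φ (r₁ * ν) ∧ MvPolynomial.aeval ![x, g₂, g₁] φ = f) :
    WeightedDrop ι S f (maximalIdeal S) ![x, g₂, g₁] ![q, r₂, r₁] :=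
  fun 𝔫 _ hT _ hv a g hfac hndvd _ =>
    hν1 _ _ (h k₀ S f hdim hf0 hf2 hiso ν hν x g₁ g₂ q r₁ r₂ hspan hrk hq hr₂ hr₁ hqh 𝔫 hT hv a g hfac hndvd)

/-! ## §4 The census dichotomy (data-driven datum axioms, jobs j281039 + j281051: 496 starts, 261 isolated, 384 σ-moves, 155 ν-tie edges) -/

/-- [OURS · R7 · (D7a) «LEVEL-RESOLVED ⇒ TIE-FREE» · candidate datum axiom · conjecture-grade] At an ISOLATED position with a σ-attaining
two-flag `(g₁, g₂; q, r₁, r₂)` (primitive weights `(q, r₂, r₁)` on `(x, g₂, g₁)`) whose level letter is INFORMATIVE — `q < r₂`, i.e. an `ℓ₂`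
exists and the level exceeds the ratio — the weighted blow-up has NO `ν`-tie successor off the vertex: the order drops at every successor prime.
Census: 159/159 such positions (42 over 𝔽_p, 117 over imperfect `K = 𝔽_p(μ…)`) tie-free; ties occur ONLY at `q = r₂`. -/
def LevelResolvedNoTie (p : ℕ) : Prop :=
  ∀ (k₀ : Type) [Field k₀] [CharP k₀ p] [PerfectField k₀]
    (S : Type) [CommRing S] [Algebra k₀ S] [Algebra.EssFiniteType k₀ S] [IsRegularLocalRing S] (f : S),
    ringKrullDim S ≤ 3 → f ≠ 0 → f ∈ (maximalIdeal S) ^ 2 → IsIsolatedPosition S f →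
    ∀ (ν : ℕ), iotaOrd S f = ν →
    ∀ (x g₁ g₂ : S) (q r₁ r₂ : ℕ),
      Ideal.span {x, g₂, g₁} = maximalIdeal S → (maximalIdeal S).spanFinrank = 3 →
      IsSigmaMaximiser f ν g₁ g₂ q r₁ r₂ → IsPrimitiveTriple q r₁ r₂ → q < r₂ →
      ∀ (𝔫 : Ideal (cobordantAlgebra' ![x, g₂, g₁] ![q, r₂, r₁])) [𝔫.IsPrime],
        cobordantT' ![x, g₂, g₁] ![q, r₂, r₁] ∈ 𝔫 →
        ¬ (extReesAlgebra.vertexIdeal (weightedMonomialIdeal ![x, g₂, g₁] ![q, r₂, r₁]) ≤ 𝔫) →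
        ∀ (a : ℕ) (g : cobordantAlgebra' ![x, g₂, g₁] ![q, r₂, r₁]),
          algebraMap S (cobordantAlgebra' ![x, g₂, g₁] ![q, r₂, r₁]) f = cobordantT' ![x, g₂, g₁] ![q, r₂, r₁] ^ a * g →
          ¬ (cobordantT' ![x, g₂, g₁] ![q, r₂, r₁] ∣ g) →
          iotaOrd (Localization.AtPrime 𝔫) (algebraMap (cobordantAlgebra' ![x, g₂, g₁] ![q, r₂, r₁]) (Localization.AtPrime 𝔫) g)
            < iotaOrd S f

/-- [OURS · R7 · (D7b) «EQUAL WEIGHTS ⇒ THE RATIO DROPS AT EVERY TIE» · candidate datum axiom · conjecture-grade] At an ISOLATED position with a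
σ-attaining two-flag with `q = r₂` (level = ratio: the binary face form `Φ(g₂, x)` is not `c·ℓ^k`), every `ν`-tie successor prime off the
vertex has STRICTLY SMALLER RATIO LETTER `σ₁` (073's scaled `iotaSigmaRatio`, same scale `ν!` on both sides of a `ν`-tie).  Heuristic: a
tie direction is a root of `Φ` of multiplicity `m` with `ν ≤ m ≤ k − 1 < k = σ₁ν/ν!…` since `Φ ≠ c·ℓ^k`; failure mode: a hidden `ν`-th power
at the successor re-absorbed by preparation.  Census: 153/153 σ-maximiser tie edges (146 slice + 7 Cohen-F13; 113 with wild stabiliser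
`p ∣ e`) drop in `σ₁`; 0 level-only drops; 0 ties; 0 rises. -/
def EqualWeightRatioDrop (p : ℕ) : Prop :=
  ∀ (k₀ : Type) [Field k₀] [CharP k₀ p] [PerfectField k₀]
    (S : Type) [CommRing S] [Algebra k₀ S] [Algebra.EssFiniteType k₀ S] [IsRegularLocalRing S] (f : S),
    ringKrullDim S ≤ 3 → f ≠ 0 → f ∈ (maximalIdeal S) ^ 2 → IsIsolatedPosition S f →
    ∀ (ν : ℕ), iotaOrd S f = ν →
    ∀ (x g₁ g₂ : S) (q r₁ r₂ : ℕ),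
      Ideal.span {x, g₂, g₁} = maximalIdeal S → (maximalIdeal S).spanFinrank = 3 →
      IsSigmaMaximiser f ν g₁ g₂ q r₁ r₂ → IsPrimitiveTriple q r₁ r₂ → q = r₂ →
      ∀ (𝔫 : Ideal (cobordantAlgebra' ![x, g₂, g₁] ![q, r₂, r₁])) [𝔫.IsPrime],
        cobordantT' ![x, g₂, g₁] ![q, r₂, r₁] ∈ 𝔫 →
        ¬ (extReesAlgebra.vertexIdeal (weightedMonomialIdeal ![x, g₂, g₁] ![q, r₂, r₁]) ≤ 𝔫) →
        ∀ (a : ℕ) (g : cobordantAlgebra' ![x, g₂, g₁] ![q, r₂, r₁]),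
          algebraMap S (cobordantAlgebra' ![x, g₂, g₁] ![q, r₂, r₁]) f = cobordantT' ![x, g₂, g₁] ![q, r₂, r₁] ^ a * g →
          ¬ (cobordantT' ![x, g₂, g₁] ![q, r₂, r₁] ∣ g) →
          iotaOrd (Localization.AtPrime 𝔫) (algebraMap (cobordantAlgebra' ![x, g₂, g₁] ![q, r₂, r₁]) (Localization.AtPrime 𝔫) g)
              = iotaOrd S f →
          iotaSigmaRatio (Localization.AtPrime 𝔫) (algebraMap (cobordantAlgebra' ![x, g₂, g₁] ![q, r₂, r₁]) (Localization.AtPrime 𝔫) g)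
            < iotaSigmaRatio S f

/-- **The dichotomy decides (K) for every `(ν, σ₁)`-monotone letter**: if `ι R g < ι S f` whenever the order drops, or the order ties and the
ratio letter drops, then (D7a) ∧ (D7b) give the isolated point-centre drop `KIsolatedDrop`-shape conclusion `WeightedDrop ι` at every isolated
position (no tameness cut, every `p`).  [folklore seam; the letter of record `ι₃ᵗ` is `(ν, σ₁)`-monotone on isolated chains GIVEN (iso-succ)
«successors of isolated positions are isolated» (`ε′ = τ′ = 0`, cylinder = point) — that reading is NOT proved here.] -/
theorem weightedDrop_of_dichotomy {p : ℕ} (hA : LevelResolvedNoTie p) (hB : EqualWeightRatioDrop p)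
    (ι : (R : Type) → [CommRing R] → R → Ordinal.{0})
    (k₀ : Type) [Field k₀] [CharP k₀ p] [PerfectField k₀]
    (S : Type) [CommRing S] [Algebra k₀ S] [Algebra.EssFiniteType k₀ S] [IsRegularLocalRing S] (f : S)
    (hι : ∀ (R : Type) [CommRing R] (g : R),
      (iotaOrd R g < iotaOrd S f ∨ (iotaOrd R g = iotaOrd S f ∧ iotaSigmaRatio R g < iotaSigmaRatio S f)) → ι R g < ι S f)
    (hdim : ringKrullDim S ≤ 3) (hf0 : f ≠ 0) (hf2 : f ∈ (maximalIdeal S) ^ 2) (hiso : IsIsolatedPosition S f)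
    {ν : ℕ} (hν : iotaOrd S f = ν) {x g₁ g₂ : S} {q r₁ r₂ : ℕ}
    (hspan : Ideal.span {x, g₂, g₁} = maximalIdeal S) (hrk : (maximalIdeal S).spanFinrank = 3)
    (hmax : IsSigmaMaximiser f ν g₁ g₂ q r₁ r₂) (hprim : IsPrimitiveTriple q r₁ r₂)
    (hle : ∀ (𝔫 : Ideal (cobordantAlgebra' ![x, g₂, g₁] ![q, r₂, r₁])) [𝔫.IsPrime] (g : cobordantAlgebra' ![x, g₂, g₁] ![q, r₂, r₁]),
      (∃ a : ℕ, algebraMap S (cobordantAlgebra' ![x, g₂, g₁] ![q, r₂, r₁]) f = cobordantT' ![x, g₂, g₁] ![q, r₂, r₁] ^ a * g) →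
      iotaOrd (Localization.AtPrime 𝔫) (algebraMap (cobordantAlgebra' ![x, g₂, g₁] ![q, r₂, r₁]) (Localization.AtPrime 𝔫) g)
        ≤ iotaOrd S f) :
    WeightedDrop ι S f (maximalIdeal S) ![x, g₂, g₁] ![q, r₂, r₁] := by
  intro 𝔫 _ hT _ hv a g hfac hndvd _
  have hqr : q ≤ r₂ := hmax.1.2.1
  rcases hqr.lt_or_eq with hlt | heq
  · exact hι _ _ (Or.inl (hA k₀ S f hdim hf0 hf2 hiso ν hν x g₁ g₂ q r₁ r₂ hspan hrk hmax hprim hlt 𝔫 hT hv a g hfac hndvd))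
  · rcases (hle 𝔫 g ⟨a, hfac⟩).lt_or_eq with hlt' | heq'
    · exact hι _ _ (Or.inl hlt')
    · exact hι _ _ (Or.inr ⟨heq', hB k₀ S f hdim hf0 hf2 hiso ν hν x g₁ g₂ q r₁ r₂ hspan hrk hmax hprim heq 𝔫 hT hv a g hfac hndvd heq'⟩)

/-! ## §5 The Cohen step behind the F13 descent (engine v3): an exact coefficient field inside the transversal DVR -/

/-- [OURS · R7 · folklore, expected PROVABLE NOW (S-sized)] **Exact coefficient field.** In a local domain `D` over a field `k`, if units
`u₁ … uₙ ∈ D` have residues that are ALGEBRAICALLY INDEPENDENT over `k` and GENERATE the residue field as a field, then `k(u₁,…,uₙ) ⊂ D` is a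
coefficient field: a `k`-subalgebra containing the `uᵢ` that the residue map carries bijectively onto the residue field (no completion needed).
Engine use (job-r7 v3, `cohen_descend`): `D = K[U_j,U_k]_{(π)}` the transversal DVR of a geometrically non-reduced successor orbit
`𝔮 = (T, U_i, π)`, `k = 𝔽_q`, the `uᵢ` = Laurent monomials in `U_j, U_k, μ, ρ` lifting a rational basis of `k(𝔮)`; then
`B̂_𝔮 = k(u)[[T, U_i, π]]` and `σ` is read there (`SigmaFormallyInvariant`). -/
def ExactCoefficientField : Prop :=
  ∀ (k D : Type) [Field k] [CommRing D] [IsDomain D] [IsLocalRing D] [Algebra k D] (n : ℕ) (u : Fin n → D),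
    AlgebraicIndependent k (fun i => IsLocalRing.residue D (u i)) →
    (∀ d : IsLocalRing.ResidueField D, ∃ a b : MvPolynomial (Fin n) k,
        MvPolynomial.aeval (fun i => IsLocalRing.residue D (u i)) b ≠ 0 ∧
        d * MvPolynomial.aeval (fun i => IsLocalRing.residue D (u i)) b = MvPolynomial.aeval (fun i => IsLocalRing.residue D (u i)) a) →
    ∃ L : Subalgebra k D, (∀ i, u i ∈ L) ∧ Function.Bijective (fun y : L => IsLocalRing.residue D (y : D))

end R7

end Iota3

end Summit.ResolutionOfSingularities.ResolutionOfSingularities.Cruxes.HypersurfaceCentreConstruction.LocalEngine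

end
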